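import Summits.ResolutionOfSingularities.ResolutionOfSingularities.Theorems.MarkedTransferCampaignW23KangarooClauseProof
import HarnessLib

/-!
# [OURS · L1 W2.3] The junk-free kangaroo-clause failure locus `KangarooPointTailsOrders` HOLDS
# (RESCUE-SEED slot W2.3 «tails without `H♭`», group L-G2; cell `res-hironaka`, rung L of LADDER-RESOLUTION)

HONEST FRAMING. Everything here is OURS (campaign bookkeeping of the cell `res-hironaka`); NOTHING is a statement of
H. Hironaka's manuscript [Hironaka2017] and nothing is attributed to its author. AI review is weaker than expert review.

CONTENT. `CampaignW23.kangarooPointTailsOrders_holds (ℓ : ℕ) : KangarooPointTailsOrders ℓ` — the `∀`-form, pinned,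
junk-free failure locus of the kangaroo clause filed as v2 of `Theorems/MarkedTransferCampaignW23KangarooClause.lean`
(p472068, OURS-DESK #28 repair of the WEAK SLICE `FlagDoesNotSelectOrder`): in the §16.4 point model at Hauser's
kangaroo point `a³` over `𝔽₂[x,y,z]` (`pointBundle ℓ L1 P`, `p = 2`, `e = 1`, `I^{(m)}(Sing) = max_ξ^m`), for EVERY
`℘nega = P` containing the two knock-outs `F³` and `(yz³)²`, the pinned tails `t₁ = x`, `t₂ = x + yz³` of the pinned
head `g = x² + F³` are both flag tails, agree modulo `max_ξ⁴`, and their knock-outs have orders `8` (`∉ max_ξ⁹`) and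
`≥ 9` (`∈ max_ξ⁹`) — residual orders `2 < 3`, the jump catalogued as
`Literature.Barriers.ResolutionOfSingularities.KangarooShadeIncrease.Hauser2003_kangarooShadeIncrease`.
The proof is the proof term of `flagDoesNotSelectOrder_holds` (p470071) read at the universally quantified bundle:
conjuncts (1)–(3) are `kangarooPointTails_holds`, (4) is `K3.knockout_x` + `K3.F_not_mem_pow_nine`, (5) is
`K3.knockout_x_add_s` + `K3.F_add_sq_mem_pow_nine`.

## References
* Tree (OURS): `Theorems/MarkedTransferCampaignW23KangarooClause.lean` v2 (p472068), `…KangarooClauseProof.lean`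
  (p470071/p470434); cell files plan/RESCUE-SEED.md §1 L-G2 W2.3, L/SLOTS.md §2 W2.3, OURS-DESK #28.
* H. Hauser, *Seventeen obstacles* (2003) §14 Ex. 2 / Bull. AMS 47 (2010) §K — as cited in the barrier file only.
  [Hauser2003] [Hauser2010]
* H. Hironaka, ms. 2017-03-23, Th. 9.18 p.55, Def. 16.15/16.16 p.88 — scope only, under adjudication. [Hironaka2017]
-/

set_option linter.dupNamespace false -- mandated namespace of this single-conjunct summit

namespace Summit.ResolutionOfSingularities.ResolutionOfSingularities.Theorems

namespace CampaignW23

/-- [OURS · L1 W2.3] `KangarooPointTailsOrders ℓ` HOLDS for every Frobenius depth `ℓ`: at Hauser's kangaroo point the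
§16.4 flag contains both the persistent tail `x` (knock-out `F³` of order `8`, `∉ max_ξ⁹`) and the re-chosen tail
`x + yz³` (knock-out `F³ + (yz³)²` of order `≥ 9`), congruent modulo `max_ξ⁴`, for every admissible `℘nega`; NOT a
statement of the manuscript. [folklore] -/
theorem kangarooPointTailsOrders_holds (ℓ : ℕ) : KangarooPointTailsOrders ℓ := by
  intro L1 P hF hs
  obtain ⟨h1, h2, h3, h4, h5⟩ := kangarooPointTails_holds ℓ L1 P hF hs
  refine ⟨h1, h2, h3, ?_, ?_⟩
  · rw [h4, zero_pow two_ne_zero, add_zero]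
    exact K3.F_not_mem_pow_nine
  · rw [h5, map_add, map_pow]
    exact K3.F_add_sq_mem_pow_nine

end CampaignW23

end Summit.ResolutionOfSingularities.ResolutionOfSingularities.Theorems
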